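import Literature.Topology.FourManifolds.Rasmussen
import Literature.Topology.FourManifolds.RasmussenProofs
import Literature.Topology.FourManifolds.DehnSurgeryProofs

/-!
# Natural strengthenings of `ZseSVanishesOnPairs` that fail in print (negative lemmas for crux stmt-SmoothPoincare4-0368)

Crux `ZeroSurgeryExotic.ZseSVanishesOnPairs` (item `stmt-SmoothPoincare4-0368`): on a `0`-surgery
pair `(K, K')` with `K` SMOOTHLY slice, every Rasmussen invariant of `K'` is `0`.  Three natural
strengthenings are FALSE IN PRINT, by one pair of knots the tree cannot yet construct; each is
recorded here as an implication from that pair, stated as a precise existential hypothesis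
(to be discharged when the objects land), to the negation of the strengthened statement:

* the TOPOLOGICAL variant (`K` only topologically slice), the `s(K) = 0` variant, and "`s` is a
  `0`-surgery invariant" all fail at the Conway knot `C = 11n34` and Piccirillo's knot `K'`:
  `X₀(C) ≅ X₀(K')` (so `S³₀(C) ≅ S³₀(K')`), `C` is topologically slice (`Δ_C = 1`, Freedman),
  `s(C) = 0`, `s(K') = 2` (Piccirillo, Ann. of Math. 191 (2020): Prop 1.4 `X(C) ≅ X(K')`, Thm 1.5 and §4 `s(K') = 2`, p. 2 `C` topologically slice; `s(C) = 0` since every computable concordance invariant of `C` vanishes — KnotInfo — which is why its sliceness stayed open until 2018) — so any proof of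
  the crux must use the SMOOTH slice disc of `K`, not any package of concordance invariants of `K`;
* the FRAMING-`m` variant fails at any `m` where the unknot and the trefoil share an `m`-surgery —
  in print `m = 5`: `S³₅(T(2,3)) = L(5,4) ≅ L(5,1) = S³₅(U)` (Moser, Pacific J. Math. 38 (1971),
  elementary surgery along a torus knot; the tree's `IsIntegralSurgery` is orientation-blind) —
  with the UNCONDITIONAL half supplied by the tree: the unknot is slice and `s(T(2,3)) = 2`
  (`hasRasmussenInvariant_torusKnot_holds`).  Framing `0` enters the crux exactly through Gabai's
  Property R / the Manolescu–Piccirillo homotopy-sphere construction.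
Refuter negative lemmas (cdisprove gen 1), supporting the crux item; no definitions.
-/

noncomputable section


open scoped Manifold ContDiff
open Literature.Topology.FourManifolds

namespace Summit.SmoothPoincare4.SmoothPoincare4.Theorems.ZseSVanishesOnPairs.Negative

/-- **The topological variant of the crux is false, given the Conway–Piccirillo pair**: if knots
`C, K'` with a common `0`-surgery exist in the tree with `C` topologically slice and `s(K') = 2`
(printed: Piccirillo 2020, Prop 1.4 — even the `0`-traces agree —, Thm 1.5 and §4 for `s(K') = 2`, p. 2 for the topological sliceness of `C`, `Δ_C = 1`, Freedman), then it is
false that on `0`-surgery pairs with `K` topologically slice `s(K')` vanishes.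
[cite: Piccirillo2020, Prop. 1.4, Thm. 1.5 and §4] -/
theorem zseSVanishesOnPairs_topological_false_of_conwayPair
    (hP : ∃ (C K' : Knot) (Y : Type) (_ : TopologicalSpace Y)
      (_ : ChartedSpace (EuclideanSpace ℝ (Fin 3)) Y),
      IsIntegralSurgery (𝓡 3) Y C 0 ∧ IsIntegralSurgery (𝓡 3) Y K' 0 ∧ C.IsTopologicallySlice ∧
        K'.HasRasmussenInvariant 2) :
    ¬ ∀ (K K' : Knot) (Y : Type) [TopologicalSpace Y] [ChartedSpace (EuclideanSpace ℝ (Fin 3)) Y]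
        (s : ℤ), IsIntegralSurgery (𝓡 3) Y K 0 → IsIntegralSurgery (𝓡 3) Y K' 0 →
        K.IsTopologicallySlice → K'.HasRasmussenInvariant s → s = 0 := by
  rintro h
  obtain ⟨C, K', Y, _, _, h1, h2, h3, h4⟩ := hP
  exact two_ne_zero (h C K' Y 2 h1 h2 h3 h4)

/-- **The `s(K) = 0` variant of the crux is false, given the Conway–Piccirillo pair** (`s(C) = 0`,
`s(K') = 2`, common `0`-surgery): `s(K) = 0` cannot replace the sliceness of `K`; a fortiori `s` is
not a `0`-surgery invariant (not even a `0`-trace invariant; cf. also the five Manolescu–Piccirillo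
pairs, `s(K) = 0`, `s(K') = 2`). [cite: Piccirillo2020, Prop. 1.4, Thm. 1.5 and §4] -/
theorem zseSVanishesOnPairs_sZero_false_of_conwayPair
    (hP : ∃ (C K' : Knot) (Y : Type) (_ : TopologicalSpace Y)
      (_ : ChartedSpace (EuclideanSpace ℝ (Fin 3)) Y),
      IsIntegralSurgery (𝓡 3) Y C 0 ∧ IsIntegralSurgery (𝓡 3) Y K' 0 ∧ C.HasRasmussenInvariant 0 ∧
        K'.HasRasmussenInvariant 2) :
    ¬ ∀ (K K' : Knot) (Y : Type) [TopologicalSpace Y] [ChartedSpace (EuclideanSpace ℝ (Fin 3)) Y]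
        (s : ℤ), IsIntegralSurgery (𝓡 3) Y K 0 → IsIntegralSurgery (𝓡 3) Y K' 0 →
        K.HasRasmussenInvariant 0 → K'.HasRasmussenInvariant s → s = 0 := by
  rintro h
  obtain ⟨C, K', Y, _, _, h1, h2, h3, h4⟩ := hP
  exact two_ne_zero (h C K' Y 2 h1 h2 h3 h4)

/-- **The framing-`m` variant of the crux is false at every `m` where the unknot and the trefoil
share an `m`-surgery** — in print `m = 5` (Moser 1971: `S³₅(T(2,3))` is the lens space
`L(5,4) ≅ L(5,1) = S³₅(U)`; read `m = -5` under the opposite framing-sign convention). The rest is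
unconditional: the unknot is slice (`isSmoothlySlice_unknot`) and `s(T(2,3)) = 2`
(`hasRasmussenInvariant_torusKnot_holds`). So the framing `0` of the crux cannot be relaxed.
[cite: Moser1971] -/
theorem zseSVanishesOnPairs_framing_false_of_commonSurgery_unknot_trefoil {m : ℤ}
    (hM : ∃ (Y : Type) (_ : TopologicalSpace Y) (_ : ChartedSpace (EuclideanSpace ℝ (Fin 3)) Y),
      IsIntegralSurgery (𝓡 3) Y unknot m ∧
        IsIntegralSurgery (𝓡 3) Y (torusKnot 2 3 le_rfl (by norm_num) (by decide)) m) :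
    ¬ ∀ (K K' : Knot) (Y : Type) [TopologicalSpace Y] [ChartedSpace (EuclideanSpace ℝ (Fin 3)) Y]
        (s : ℤ), IsIntegralSurgery (𝓡 3) Y K m → IsIntegralSurgery (𝓡 3) Y K' m →
        K.IsSmoothlySlice → K'.HasRasmussenInvariant s → s = 0 := by
  rintro h
  obtain ⟨Y, _, _, hU, hT⟩ := hM
  have hs : (torusKnot 2 3 le_rfl (by norm_num) (by decide)).HasRasmussenInvariant 2 := by
    have h' := hasRasmussenInvariant_torusKnot_holds 2 3 le_rfl (by norm_num) (by decide)
    norm_num at h'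
    exact h'
  exact two_ne_zero (h unknot _ Y 2 hU hT isSmoothlySlice_unknot hs)

end Summit.SmoothPoincare4.SmoothPoincare4.Theorems.ZseSVanishesOnPairs.Negative
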